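import Summits.Ventures.QEDPrecision.ThreeLoop.RederivationTargets

/-!
# ThreeLoop/RederivationIdentityHolds — the qed-ibp cell's exact reduction identity, kernel-checked by a second hand

HONEST FRAMING. `ReductionIdentity` (typed target, `ThreeLoop/RederivationTargets.lean`, rung Q6 of the venture, never
summit-bearing) states the qed-ibp cell's exact three-loop reduction as four rational identities: row `ε⁰` reproduces the published
`A₁⁽⁶⁾` closed form `a1Six` [LaportaRemiddi1996, eq. (5)] from the cell's reduction rationals `c` times the published analytic master
coefficients [LeeSmirnov2011, §3], and rows `ε⁻¹, ε⁻², ε⁻³` are exact pole cancellation.  This file closes it in the kernel: with the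
published closed forms substituted, the cell's rationals reproduce eq. (5) EXACTLY and all poles cancel — the cell's «0c CLOSED-EXACT»
record (STEP0-RESULT v1 §2 row 0c; HOME/STATUS 2026-08-25).  Landed by the REFEREE seat (qed-ibp-ref g13) as the second hand on the
planner's check (lead g5, `route/RederivationTargetsCheck.lean`, rc 0): the proof is the kernel's, the second hand is the point.
Nothing numerical is asserted here; the masters-enclosure half of rung Q6 (`MastersEnclosed`) remains a typed target, open until the
cell's own master digits are enclosed.  Reproduction programme; no new-physics claim.
-/

namespace Summit.Ventures.QEDPrecision.ThreeLoop

set_option maxHeartbeats 1600000 in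
/-- The cell's exact three-loop reduction identity holds: row `ε⁰` reproduces `a1Six` [LaportaRemiddi1996, eq. (5)] exactly and the
three pole rows cancel exactly, with the published master coefficients [LeeSmirnov2011, §3] substituted for the `M_Gj_k`.
Second-hand kernel check of the planner's `route/RederivationTargetsCheck.lean` example (referee seat). -/
theorem reductionIdentity_holds : ReductionIdentity := by
  simp only [ReductionIdentity, Literature.MathematicalPhysics.QuantumFieldTheory.LaportaRemiddi1996.a1Six]
  refine ⟨?_, ?_, ?_, ?_⟩ <;> ring

end Summit.Ventures.QEDPrecision.ThreeLoop
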